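import Summits.CriticalPhenomena.PercolationContinuityZ3.Theorems.PercNearOneGluingNoHeavyLowerTailIncStarApexForestConcave
import Summits.CriticalPhenomena.PercolationContinuityZ3.Theorems.PercNearOneGluingNoHeavyLowerTailIncStarApexForest
import HarnessLib

/-!
# One-pair BERNSTEIN POSITIVITY of the increasing star on apex-forests (corollary of THEOREM FC and THEOREM C)

Support file for the Sahi programme (`--supports stmt-CriticalPhenomena-4575`, prover prim-sahi-p2 gen 20).  No definitions, no named
facts, no sorries; standard axioms.  Memo `run/shared/lean/prim/prim-sahi/prim-sahi-p2/PROOF-E3.md` §30; the Bernstein language of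
`…FrontierDecRowsEdgeInduction` (`EdgeInduction.sahiE3_oneBond`: along one pair `e`, `E₃(w) = Σ_j C(3,j) p^j (1−p)^{3−j} B_j` with
`B₀ = E₃(w[e↦0])`, `B₁ = polar₁(P₀,P₁)`, `B₂ = polar₁(P₁,P₀)`, `B₃ = E₃(w[e↦1])`) and of the gen-4…7 schemas (`…IncStarRootEdgeInduction`,
`…IncStarKeyBernstein`: the increasing star on all graphs would follow from Bernstein positivity along suitable pairs).

* THEOREM C is imported from `…IncStarApexForest` (`IncStar.incStar_nonneg_of_apexForest`).
* `incStar_bernstein_nonneg_of_apexForest` — **for every non-diagonal pair `e` with the environment-with-`e` acyclic, ALL FOUR Bernstein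
  coefficients of `E₃` along `e` are nonnegative**: `B₀, B₃ ≥ 0` by THEOREM C, and `B₁, B₂ ≥ 0` because THEOREM FC's three-point inequality at
  `(0, ⅓, ⅔)` and `(⅓, ⅔, 1)` reads `3B₁ ≥ 2B₀ + B₃`, `3B₂ ≥ B₀ + 2B₃` (discrete concavity of `f(0), f(⅓), f(⅔), f(1)`).
-/

noncomputable section

namespace Summit.CriticalPhenomena.PercolationContinuityZ3.Theorems

namespace IncStar

open MeasureTheory Set Literature.Probability.Percolation Literature.Probability.LatticeModels EdgeInduction
open scoped Classical

variable {n : ℕ}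

/-- **One-pair Bernstein positivity on apex-forests.**  For every non-diagonal pair `e` such that the environment with `e` switched on is
acyclic, the two mixed Bernstein coefficients of `E₃({s↔a},{s↔b},{s↔c})` along `e` are nonnegative (the extreme ones are THEOREM C for
`w[e↦0]`, `w[e↦1]`). [this work] -/
theorem incStar_bernstein_nonneg_of_apexForest (w : Sym2 (Fin n) → unitInterval) (s a b c : Fin n) (e : Sym2 (Fin n))
    (he : ¬ e.IsDiag)
    (hforest : (SimpleGraph.fromEdgeSet {z : Sym2 (Fin n) | s ∉ z ∧ Function.update w e 1 z ≠ 0}).IsAcyclic) :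
    0 ≤ polar₁ (prodBernoulli (Function.update w e 0)) (prodBernoulli (Function.update w e 1)) (openConn s a) (openConn s b) (openConn s c)
      ∧ 0 ≤ polar₁ (prodBernoulli (Function.update w e 1)) (prodBernoulli (Function.update w e 0)) (openConn s a) (openConn s b) (openConn s c)
      ∧ 0 ≤ sahiE3 (prodBernoulli (Function.update w e 0)) (openConn s a) (openConn s b) (openConn s c)
      ∧ 0 ≤ sahiE3 (prodBernoulli (Function.update w e 1)) (openConn s a) (openConn s b) (openConn s c) := by
  -- the extreme coefficients: THEOREM C for the pinned weights
  have hf1 : (SimpleGraph.fromEdgeSet {z : Sym2 (Fin n) | s ∉ z ∧ Function.update w e 1 z ≠ 0}).IsAcyclic := hforest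
  have hf0 : (SimpleGraph.fromEdgeSet {z : Sym2 (Fin n) | s ∉ z ∧ Function.update w e 0 z ≠ 0}).IsAcyclic := by
    refine hforest.anti fun x y hxy => ?_
    rw [SimpleGraph.fromEdgeSet_adj] at hxy ⊢
    obtain ⟨⟨hs, hw⟩, hne⟩ := hxy
    refine ⟨⟨hs, ?_⟩, hne⟩
    by_cases h : s(x, y) = e
    · rw [h, Function.update_self] at hw; exact absurd rfl hw
    · rw [Function.update_of_ne h] at hw
      rw [Function.update_of_ne h]
      exact hw
  have B0 := incStar_nonneg_of_apexForest (Function.update w e 0) s a b c hf0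
  have B3 := incStar_nonneg_of_apexForest (Function.update w e 1) s a b c hf1
  -- the Bernstein expansion of `E₃(w[e↦q])`
  have exp : ∀ q : unitInterval, sahiE3 (prodBernoulli (Function.update w e q)) (openConn s a) (openConn s b) (openConn s c)
      = (1 - (q : ℝ)) ^ 3 * sahiE3 (prodBernoulli (Function.update w e 0)) (openConn s a) (openConn s b) (openConn s c)
        + 3 * (q : ℝ) * (1 - (q : ℝ)) ^ 2
          * polar₁ (prodBernoulli (Function.update w e 0)) (prodBernoulli (Function.update w e 1)) (openConn s a) (openConn s b) (openConn s c)
        + 3 * (q : ℝ) ^ 2 * (1 - (q : ℝ))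
          * polar₁ (prodBernoulli (Function.update w e 1)) (prodBernoulli (Function.update w e 0)) (openConn s a) (openConn s b) (openConn s c)
        + (q : ℝ) ^ 3 * sahiE3 (prodBernoulli (Function.update w e 1)) (openConn s a) (openConn s b) (openConn s c) := by
    intro q
    have h := sahiE3_oneBond (Function.update w e q) e (openConn s a) (openConn s b) (openConn s c)
    rwa [Function.update_idem, Function.update_idem, Function.update_self] at h
  -- THEOREM FC at `(0, 1/3, 2/3)` and `(1/3, 2/3, 1)`
  have m13 : (1 / 3 : ℝ) ∈ unitInterval := Set.mem_Icc.2 ⟨by norm_num, by norm_num⟩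
  have m23 : (2 / 3 : ℝ) ∈ unitInterval := Set.mem_Icc.2 ⟨by norm_num, by norm_num⟩
  have o1 : (0 : unitInterval) ≤ ⟨1 / 3, m13⟩ := by
    have h : ((0 : unitInterval) : ℝ) ≤ ((⟨1 / 3, m13⟩ : unitInterval) : ℝ) := by norm_num
    exact_mod_cast h
  have o2 : (⟨1 / 3, m13⟩ : unitInterval) ≤ ⟨2 / 3, m23⟩ := by
    have h : ((⟨1 / 3, m13⟩ : unitInterval) : ℝ) ≤ ((⟨2 / 3, m23⟩ : unitInterval) : ℝ) := by norm_num
    exact_mod_cast h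
  have o3 : (⟨2 / 3, m23⟩ : unitInterval) ≤ 1 := by
    have h : ((⟨2 / 3, m23⟩ : unitInterval) : ℝ) ≤ ((1 : unitInterval) : ℝ) := by norm_num
    exact_mod_cast h
  have h1 := incStar_pair_threePoint_of_apexForest w s a b c e he hforest 0 ⟨1 / 3, m13⟩ ⟨2 / 3, m23⟩ o1 o2
  have h2 := incStar_pair_threePoint_of_apexForest w s a b c e he hforest ⟨1 / 3, m13⟩ ⟨2 / 3, m23⟩ 1 o2 o3
  rw [exp ⟨1 / 3, m13⟩, exp ⟨2 / 3, m23⟩] at h1 h2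
  norm_num at h1 h2
  refine ⟨by linarith, by linarith, B0, B3⟩

end IncStar

end Summit.CriticalPhenomena.PercolationContinuityZ3.Theorems
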